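import Summits.HodgeConjecture.HodgeCM.Model.AdelicThetaDistributionMultEndG_1

/-! PORT of `HodgeCM/Model/AdelicThetaDistributionMultEndG.lean` (HodgeCMPerL run 82) — part 2: continuation of `Summits.HodgeConjecture.HodgeCM.Model.AdelicThetaDistributionMultEndG_1` (split at a top-level declaration boundary by port_pkg.py; scope re-opened below; declarations unchanged). -/

-- port_pkg: scope re-opened for this part (file-level context, then the namespace/section stack open at the cut)
set_option autoImplicit false
noncomputable section
open MeasureTheory MulAction IsDedekindDomain NumberField.mixedEmbedding
open NumberField hiding relNormOneIdeles relNormOneRat probHaarRelNormOneQuot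
open scoped Matrix TensorProduct Classical SchwartzMap
open Literature.NumberTheory.Automorphic Literature.NumberTheory.Automorphic.UnitaryGroup Literature.NumberTheory.Weil1964
open Literature.NumberTheory.GelbartRogawski1991 Literature.NumberTheory.GelbartRogawski1991.UnitaryDualPair
open Literature.Geometry.ComplexHyperbolic.BallModel (U21 x₀)
open Literature.AlgebraicGeometry.HodgeTheory Literature.AlgebraicGeometry.ShimuraVarieties
open Literature.NumberTheory.Automorphic.PicardCM
open Literature.NumberTheory.Transcendental (Arapura2012_Cor_15_4_6)
open HodgeCM.Adelic HodgeCM.PerL34 HodgeCM.Model.HypCensus HodgeCM.Model.ArchSideTerm HodgeCM.Model.ThetaDistFin HodgeCM.Model.TowerCarrier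
open HodgeCM.Model.SupplyInstance HodgeCM.Model.SupplyResidual HodgeCM.Model.ThetaSpace
open HodgeCM.Model.SupplyResidual.WeilPairData (charInv)
namespace HodgeCM.Model
namespace ThetaAdelicSide
variable (hHD : exists_isReal_hodgeModel) (hI : hodgePQ_independent_of_hodgeModel)
  (h₁ : BallQuotientUniformised) (h₃ : CMAbelianVarietyRealised) (hA : Arapura2012_Cor_15_4_6)
variable {L : CMField} {ι₁ : L →+* ℂ} (V : HermSpace3 L ι₁) (c : SeesawCtx L)
  (hGR : (cmSplittingDatum (L : Type) finProdFinEquiv (frameD V) (frameD_real V) (frameD_ne V) (dW c.D) (dW_real c.D)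
    (dW_ne c.D)).CompatibleSplitting)
  (hGR₀ : (cmSplittingDatum (L : Type) (e₁) (frameD V) (frameD_real V) (frameD_ne V) (lineVec (L : Type) (dW c.D 0))
    (fun _ => dW_real c.D 0) (fun _ => dW_ne c.D 0)).CompatibleSplitting)
  (hGR₁ : (cmSplittingDatum (L : Type) (e₁) (frameD V) (frameD_real V) (frameD_ne V) (lineVec (L : Type) (dW c.D 1))
    (fun _ => dW_real c.D 1) (fun _ => dW_ne c.D 1)).CompatibleSplitting)
  (hGR₂ : (cmSplittingDatum (L : Type) (e₁) (frameD V) (frameD_real V) (frameD_ne V) (lineVec (L : Type) (dW' c.D 0))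
    (fun _ => dW'_real c.D 0) (fun _ => dW'_ne c.D 0)).CompatibleSplitting)
  (hGR₃ : (cmSplittingDatum (L : Type) (e₁) (frameD V) (frameD_real V) (frameD_ne V) (lineVec (L : Type) (dW' c.D 1))
    (fun _ => dW'_real c.D 1) (fun _ => dW'_ne c.D 1)).CompatibleSplitting)
  (χ₀ χ₁ χ₂ χ₃ : CMAdelic (L : Type) (frameD V) × CMAdelicOne (L : Type) →* ℂˣ)
  (hV : IsAnisotropic L V.Hm)
section DefaultSplit
variable
  (η : CMAdelic (L : Type) (frameD V) × CMAdelic (L : Type) (dW c.D) →* ℂˣ)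
  (hη : ∀ γU ∈ CMRat (L : Type) (frameD V), ∀ γ ∈ CMRat (L : Type) (dW c.D), η (γU, γ) = 1)
  (hηc : Continuous fun p => ((η p : ℂˣ) : ℂ))
  (h₁W : (∀ j, 0 < (ι₁ (dW c.D j)).re) ∨ ∀ j, (ι₁ (dW c.D j)).re < 0)
  (A : ∀ k : Fin 4, ArchLineInput V (lineRepD V c.D hGR hGR₀ hGR₁ hGR₂ hGR₃ η k))
/-- Certification (a named theorem here; an `example` in the HodgeCMPerL source): the slot-0 END statement is the
`rfl` instance of `clsU_mem_iSup_block_of_mem_holSat_of_lineRepOf_zero` at `thetaDistDatumZeroOf`. -/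
theorem thetaDistDatumZeroOf_clsU_mem_iSup_block
    (Φ₀ : Module.Dual ℂ (Fin 2 → ℂ) →ₗ[ℂ] 𝓢((Fin 3 → mixedSpace (↥(maximalRealSubfield L))), ℂ))
    (harm₀ : ∀ (u : ↥(stabilizer U21 x₀)) (ℓ : Module.Dual ℂ (Fin 2 → ℂ)),
      lineOmega_zero V c.D hGR hGR₀ hGR₁ (eta₀ V c.D η) (u : U21) (Φ₀ ℓ) =
        Φ₀ ((BallForms.isPullbackCocycle_cotangentCocycle.weightOf x₀).dual u ℓ))
    (hdef₀ : ∀ a : UnitaryGroup.arch (↥(maximalRealSubfield L)) L (IsCMField.complexConj L) 3 V.Hm,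
      UnitaryGroup.archAt (↥(maximalRealSubfield L)) L (IsCMField.complexConj L) 3 V.Hm (UnitaryGroup.cmPlace (L : Type) ι₁)
          (NumberField.complexConj_smul_infinitePlace (L : Type) _) (IsCMField.complexConj_ne_one (L : Type)) a = 1 →
      ∀ (ℓ : Module.Dual ℂ (Fin 2 → ℂ)) (Φf : FinSB (↥(maximalRealSubfield L)) (Fin 3)),
        lineRepOf V c.D hGR hGR₀ hGR₁ hGR₂ hGR₃ (eta₀ V c.D η) (eta₁ V c.D η) (eta₂ V c.D η) (eta₃ V c.D η) 0
            (HodgeCM.Adelic.regimeEquiv L V.Hm hV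
              (UnitaryGroup.archToAdelic (↥(maximalRealSubfield L)) L (IsCMField.complexConj L) 3 V.Hm a), 1)
            (piSchwartzBruhatEquiv (↥(maximalRealSubfield L)) (Fin 3) (Φ₀ ℓ ⊗ₜ[ℂ] Φf)) =
          piSchwartzBruhatEquiv (↥(maximalRealSubfield L)) (Fin 3) (Φ₀ ℓ ⊗ₜ[ℂ] Φf))
    (hd₀ : ∀ (T : 𝓢((Fin 3 → mixedSpace (↥(maximalRealSubfield L))), ℂ) →L[ℂ] ℂ) (ℓ : Module.Dual ℂ (Fin 2 → ℂ)),
      DifferentiableAt ℝ (fun b => T (lineOmega_zero V c.D hGR hGR₀ hGR₁ (eta₀ V c.D η) (BallForms.expP b) (Φ₀ ℓ))) 0)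
    (hCR₀ : ∀ (T : 𝓢((Fin 3 → mixedSpace (↥(maximalRealSubfield L))), ℂ) →L[ℂ] ℂ) (ℓ : Module.Dual ℂ (Fin 2 → ℂ)) (v : Fin 2 → ℂ),
      fderiv ℝ (fun b => T (lineOmega_zero V c.D hGR hGR₀ hGR₁ (eta₀ V c.D η) (BallForms.expP b) (Φ₀ ℓ))) 0 (Complex.I • v) =
        Complex.I • fderiv ℝ (fun b => T (lineOmega_zero V c.D hGR hGR₀ hGR₁ (eta₀ V c.D η) (BallForms.expP b) (Φ₀ ℓ))) 0 v)
    {𝓕 : Set C(↥(relNormOneIdeles (↥(maximalRealSubfield L)) L) ⧸ relNormOneRat (↥(maximalRealSubfield L)) L, ℂ)}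
    (h𝓕 : ∀ f ∈ 𝓕, ∃ χ : PontryaginDual (↥(relNormOneIdeles (↥(maximalRealSubfield L)) L) ⧸ relNormOneRat (↥(maximalRealSubfield L)) L),
      f = charInv χ)
    (hΦ : Φ₀ ≠ 0) (hι : (archSideOf V c hGR hGR₀ hGR₁ hGR₂ hGR₃ η hη hηc h₁W A).ιinf = archInfOf V) (Γ : Level V)
    {F : (V.latticeModel printFact_unitaryCompact_holds).G → (Fin 2 → ℂ)}
    (hF : F ∈ (archSideOf V c hGR hGR₀ hGR₁ hGR₂ hGR₃ η hη hηc h₁W A).holSat hV 0 Γ 𝓕) :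
    ∃ hF' : F ∈ (archSideOf V c hGR hGR₀ hGR₁ hGR₂ hGR₃ η hη hηc h₁W A).holSatU hV 0 𝓕,
      (archSideOf V c hGR hGR₀ hGR₁ hGR₂ hGR₃ η hη hηc h₁W A).clsU hHD hI h₁ h₃ hA 𝓕 hι hV 0 ⟨F, hF'⟩ ∈
        ⨆ (χ : PontryaginDual (↥(relNormOneIdeles (↥(maximalRealSubfield L)) L) ⧸ relNormOneRat (↥(maximalRealSubfield L)) L))
          (_ : charInv χ ∈ 𝓕),
          ⨆ ψ : ((thetaDistDatumZeroOf V c hGR hGR₀ hGR₁ hGR₂ hGR₃ η hη hηc h₁W A hV Φ₀ harm₀ hdef₀).coinvRep χ).asModule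
              →ₗ[MonoidAlgebra ℂ ↥V.adelicFin] Tower hHD hI (ballQuotientUniformisedDatum_of h₁) h₃ hA V,
            (LinearMap.range ψ).restrictScalars ℂ :=
  (thetaDistDatumZeroOf V c hGR hGR₀ hGR₁ hGR₂ hGR₃ η hη hηc h₁W A hV Φ₀ harm₀ hdef₀).clsU_mem_iSup_block_of_mem_holSat_of_lineRepOf_zero
    hHD hI h₁ h₃ hA hGR hGR₀ hGR₁ hGR₂ hGR₃ (eta₀ V c.D η) (eta₁ V c.D η) (eta₂ V c.D η) (eta₃ V c.D η)
    h𝓕 rfl rfl hΦ (satG_le_archSideOf_Gfin V c hGR hGR₀ hGR₁ hGR₂ hGR₃ η hη hηc h₁W A hV)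
    (isLFAction_archSideOf V c hGR hGR₀ hGR₁ hGR₂ hGR₃ η hη hηc h₁W A 0) hd₀ hCR₀ hι Γ hF

/-- Certification (a named theorem here; an `example` in the HodgeCMPerL source): #R126's slot-2 end statement IS the
`rfl` instance of § 2 (`clsU_mem_iSup_block_of_mem_holSat_of_lineRepOf_two` at `thetaDistDatumTwoOf`). -/
theorem thetaDistDatumTwoOf_clsU_mem_iSup_block
    (Φ₂ : Module.Dual ℂ (Fin 2 → ℂ) →ₗ[ℂ] 𝓢((Fin 3 → mixedSpace (↥(maximalRealSubfield L))), ℂ))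
    (harm₂ : ∀ (u : ↥(stabilizer U21 x₀)) (ℓ : Module.Dual ℂ (Fin 2 → ℂ)),
      lineOmega_two V c.D hGR hGR₂ hGR₃ (eta₂ V c.D η) (u : U21) (Φ₂ ℓ) =
        Φ₂ ((BallForms.isPullbackCocycle_cotangentCocycle.weightOf x₀).dual u ℓ))
    (hdef₂ : ∀ a : UnitaryGroup.arch (↥(maximalRealSubfield L)) L (IsCMField.complexConj L) 3 V.Hm,
      UnitaryGroup.archAt (↥(maximalRealSubfield L)) L (IsCMField.complexConj L) 3 V.Hm (UnitaryGroup.cmPlace (L : Type) ι₁)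
          (NumberField.complexConj_smul_infinitePlace (L : Type) _) (IsCMField.complexConj_ne_one (L : Type)) a = 1 →
      ∀ (ℓ : Module.Dual ℂ (Fin 2 → ℂ)) (Φf : FinSB (↥(maximalRealSubfield L)) (Fin 3)),
        lineRepOf V c.D hGR hGR₀ hGR₁ hGR₂ hGR₃ (eta₀ V c.D η) (eta₁ V c.D η) (eta₂ V c.D η) (eta₃ V c.D η) 2
            (HodgeCM.Adelic.regimeEquiv L V.Hm hV
              (UnitaryGroup.archToAdelic (↥(maximalRealSubfield L)) L (IsCMField.complexConj L) 3 V.Hm a), 1)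
            (piSchwartzBruhatEquiv (↥(maximalRealSubfield L)) (Fin 3) (Φ₂ ℓ ⊗ₜ[ℂ] Φf)) =
          piSchwartzBruhatEquiv (↥(maximalRealSubfield L)) (Fin 3) (Φ₂ ℓ ⊗ₜ[ℂ] Φf))
    (hd₂ : ∀ (T : 𝓢((Fin 3 → mixedSpace (↥(maximalRealSubfield L))), ℂ) →L[ℂ] ℂ) (ℓ : Module.Dual ℂ (Fin 2 → ℂ)),
      DifferentiableAt ℝ (fun b => T (lineOmega_two V c.D hGR hGR₂ hGR₃ (eta₂ V c.D η) (BallForms.expP b) (Φ₂ ℓ))) 0)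
    (hCR₂ : ∀ (T : 𝓢((Fin 3 → mixedSpace (↥(maximalRealSubfield L))), ℂ) →L[ℂ] ℂ) (ℓ : Module.Dual ℂ (Fin 2 → ℂ)) (v : Fin 2 → ℂ),
      fderiv ℝ (fun b => T (lineOmega_two V c.D hGR hGR₂ hGR₃ (eta₂ V c.D η) (BallForms.expP b) (Φ₂ ℓ))) 0 (Complex.I • v) =
        Complex.I • fderiv ℝ (fun b => T (lineOmega_two V c.D hGR hGR₂ hGR₃ (eta₂ V c.D η) (BallForms.expP b) (Φ₂ ℓ))) 0 v)
    {𝓕 : Set C(↥(relNormOneIdeles (↥(maximalRealSubfield L)) L) ⧸ relNormOneRat (↥(maximalRealSubfield L)) L, ℂ)}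
    (h𝓕 : ∀ f ∈ 𝓕, ∃ χ : PontryaginDual (↥(relNormOneIdeles (↥(maximalRealSubfield L)) L) ⧸ relNormOneRat (↥(maximalRealSubfield L)) L),
      f = charInv χ)
    (hΦ : Φ₂ ≠ 0) (hι : (archSideOf V c hGR hGR₀ hGR₁ hGR₂ hGR₃ η hη hηc h₁W A).ιinf = archInfOf V) (Γ : Level V)
    {F : (V.latticeModel printFact_unitaryCompact_holds).G → (Fin 2 → ℂ)}
    (hF : F ∈ (archSideOf V c hGR hGR₀ hGR₁ hGR₂ hGR₃ η hη hηc h₁W A).holSat hV 2 Γ 𝓕) :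
    ∃ hF' : F ∈ (archSideOf V c hGR hGR₀ hGR₁ hGR₂ hGR₃ η hη hηc h₁W A).holSatU hV 2 𝓕,
      (archSideOf V c hGR hGR₀ hGR₁ hGR₂ hGR₃ η hη hηc h₁W A).clsU hHD hI h₁ h₃ hA 𝓕 hι hV 2 ⟨F, hF'⟩ ∈
        ⨆ (χ : PontryaginDual (↥(relNormOneIdeles (↥(maximalRealSubfield L)) L) ⧸ relNormOneRat (↥(maximalRealSubfield L)) L))
          (_ : charInv χ ∈ 𝓕),
          ⨆ ψ : ((thetaDistDatumTwoOf V c hGR hGR₀ hGR₁ hGR₂ hGR₃ η hη hηc h₁W A hV Φ₂ harm₂ hdef₂).coinvRep χ).asModule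
              →ₗ[MonoidAlgebra ℂ ↥V.adelicFin] Tower hHD hI (ballQuotientUniformisedDatum_of h₁) h₃ hA V,
            (LinearMap.range ψ).restrictScalars ℂ :=
  (thetaDistDatumTwoOf V c hGR hGR₀ hGR₁ hGR₂ hGR₃ η hη hηc h₁W A hV Φ₂ harm₂ hdef₂).clsU_mem_iSup_block_of_mem_holSat_of_lineRepOf_two
    hHD hI h₁ h₃ hA hGR hGR₀ hGR₁ hGR₂ hGR₃ (eta₀ V c.D η) (eta₁ V c.D η) (eta₂ V c.D η) (eta₃ V c.D η)
    h𝓕 rfl rfl hΦ (satG_le_archSideOf_Gfin V c hGR hGR₀ hGR₁ hGR₂ hGR₃ η hη hηc h₁W A hV)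
    (isLFAction_archSideOf V c hGR hGR₀ hGR₁ hGR₂ hGR₃ η hη hηc h₁W A 2) hd₂ hCR₂ hι Γ hF

end DefaultSplit

end ThetaAdelicSide
end HodgeCM.Model

end
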